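import Literature.Geometry.Lorentzian.AsymptoticFlatnessEnergy
import Literature.Geometry.Lorentzian.AsymptoticFlatnessTransition
import Literature.Geometry.Lorentzian.ADMFluxTransformation
import HarnessLib

/-!
# Bartnik's uniqueness theorem for the ADM energy (discharge)

This file proves the named fact `AFEnd.HasADMEnergy.Of_isSameEnd` (`AsymptoticFlatness`):
**the ADM energy does not depend on the structure at infinity** (Bartnik, CPAM 39 (1986),
Thm. 4.2 with Cor. 3.2; Chruściel 1986). If `e`, `e'` are two end structures of the same end of the
`3`-manifold `X`, in both of which the metric is asymptotically flat of order `α > 1/2`, and the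
ADM fluxes of `e` converge to `m`, then so do those of `e'`.

Proof (Bartnik's, reorganised so that only *round* coordinate spheres of either chart occur):

1. (`AsymptoticFlatnessTransition`) the two charts are related by the transition map `x = G(y)`,
   smooth far out, with `h'(y)(v,w) = h(Gy)(DG v, DG w)`, and `IsSameEnd` makes `G`, `G'` proper;
   the decay hypotheses give the analytic package `TransitionRigidity.TransitionDecay`
   (`exists_transitionDecay`, with `α₀ = min α (3/4) ∈ (1/2, 1)`);
2. (`ADMTransitionRotation`, Bartnik Cor. 3.2) `DG → O ∈ O(3)` with `DG − O = O(r^{−α₀})`,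
   `D²G = O(r^{−1−α₀})`, `G − O = O(r^{1−α₀})`;
3. (`ADMFluxTransformation`, Bartnik (4.8)–(4.9)) pointwise on the sphere `‖y‖ = r`:
   `⟪ŷ, V'(y)⟫ = ⟪(Oy)^, V(Oy)⟫ + ⟪ŷ, c̃(y)⟫ + O(r^{−2α₀−1})`, with `c̃` a curl field;
4. (`ADMFrameIndependence`) the flux of `c̃` through round spheres vanishes (Gauss–Green on
   shells), and (Mathlib) `μHE[2]` on round spheres is invariant under the isometry `O`, so
   `∮_{S_r} ⟪(Oy)^, V(Oy)⟫ = ∮_{S_r} ⟪x̂, V(x)⟫ = 16π E(r)`;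
5. hence `|E'(r) − E(r)| ≤ C r^{−2α₀−1} μHE[2](S_r) = C' r^{1−2α₀} → 0`.

The hypothesis `R(h) ∈ L¹` of the fact is not needed for this implication (it serves the
existence of the limit for `e`, which is assumed here); Bartnik needs it only in Prop. 4.1.

## References

* R. Bartnik, *The mass of an asymptotically flat manifold*, CPAM 39 (1986), §3, Cor. 3.2 and
  §4, (4.8)–(4.9), Thm. 4.2.
* P. T. Chruściel, *Boundary conditions at spatial infinity from a Hamiltonian point of view*,
  in: Topological properties and global structure of space-time (1986).
-/

noncomputable section

-- instance search on the nested operator spaces of metric components and their derivatives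
-- (`E3 →L[ℝ] E3 →L[ℝ] E3 →L[ℝ] E3 →L[ℝ] ℝ` for second derivatives) is deep and slow on `E3`
set_option maxSynthPendingDepth 3
set_option synthInstance.maxHeartbeats 200000

open Manifold Bundle TopologicalSpace Filter Metric MeasureTheory Asymptotics Bornology
open scoped ContDiff Topology RealInnerProductSpace

namespace Literature.Geometry.Lorentzian

namespace AFEnd

variable {X : Type*} [TopologicalSpace X] [ChartedSpace E3 X] [IsManifold (𝓡 3) ∞ X]
  (e e' : AFEnd X) (D : InitialDataSet (𝓡 3) X)

/-! ### Decay constants from asymptotic flatness -/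

/-- **Decay constants.** Metric asymptotic flatness of order `α` gives, for any `α₀ ≤ α`, a
constant `K ≥ 0` and a radius `ρ` with `‖h − δ‖ ≤ K r^{−α₀}`, `‖Dh‖ ≤ K r^{−α₀−1}`,
`‖D²h‖ ≤ K r^{−α₀−2}` on `{ρ ≤ ‖x‖}` (the `O(·)` constants of the three `iteratedFDeriv` bounds,
and `r^{−α−m} ≤ r^{−α₀−m}` for `r ≥ 1`). Bartnik 1986, Def. 2.1 (`C²` form). [cite: Bartnik1986, §2, Def. 2.1] -/
theorem exists_decay_bounds {α α₀ : ℝ} (hα₀ : α₀ ≤ α) (hAF : IsMetricAsymptoticallyFlat e D α) :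
    ∃ K ρ : ℝ, 0 ≤ K ∧ ∀ x : E3, ρ ≤ ‖x‖ →
      ‖hCoeff e D x - (innerSL ℝ : E3 →L[ℝ] E3 →L[ℝ] ℝ)‖ ≤ K * ‖x‖ ^ (-α₀) ∧
      ‖fderiv ℝ (hCoeff e D) x‖ ≤ K * ‖x‖ ^ (-α₀ - 1) ∧
      ‖fderiv ℝ (fderiv ℝ (hCoeff e D)) x‖ ≤ K * ‖x‖ ^ (-α₀ - 2) := by
  obtain ⟨c₀, hc₀, h0⟩ := (hAF 0 (by norm_num)).exists_pos
  obtain ⟨c₁, hc₁, h1⟩ := (hAF 1 (by norm_num)).exists_pos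
  obtain ⟨c₂, hc₂, h2⟩ := (hAF 2 (by norm_num)).exists_pos
  have hfd : ∀ y, fderiv ℝ (fun y ↦ hCoeff e D y - (innerSL ℝ : E3 →L[ℝ] E3 →L[ℝ] ℝ)) y =
      fderiv ℝ (hCoeff e D) y := fun y ↦ fderiv_sub_const _
  have hfdd : fderiv ℝ (fderiv ℝ (fun y ↦ hCoeff e D y - (innerSL ℝ : E3 →L[ℝ] E3 →L[ℝ] ℝ))) =
      fderiv ℝ (fderiv ℝ (hCoeff e D)) := by
    have : fderiv ℝ (fun y ↦ hCoeff e D y - (innerSL ℝ : E3 →L[ℝ] E3 →L[ℝ] ℝ)) =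
        fderiv ℝ (hCoeff e D) := funext hfd
    rw [this]
  set K : ℝ := max c₀ (max c₁ c₂) with hK
  have hK0 : 0 ≤ K := hc₀.le.trans (le_max_left _ _)
  have hev : ∀ᶠ x in cobounded E3,
      ‖hCoeff e D x - (innerSL ℝ : E3 →L[ℝ] E3 →L[ℝ] ℝ)‖ ≤ K * ‖x‖ ^ (-α₀) ∧
      ‖fderiv ℝ (hCoeff e D) x‖ ≤ K * ‖x‖ ^ (-α₀ - 1) ∧
      ‖fderiv ℝ (fderiv ℝ (hCoeff e D)) x‖ ≤ K * ‖x‖ ^ (-α₀ - 2) := by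
    filter_upwards [h0.bound, h1.bound, h2.bound, eventually_cobounded_le_norm (E := E3) 1]
      with x hx0 hx1 hx2 hx1'
    have hxpos : 0 < ‖x‖ := by linarith
    rw [norm_norm, norm_iteratedFDeriv_zero, Real.norm_of_nonneg (Real.rpow_nonneg hxpos.le _)]
      at hx0
    rw [norm_norm, norm_iteratedFDeriv_one, hfd,
      Real.norm_of_nonneg (Real.rpow_nonneg hxpos.le _)] at hx1
    rw [norm_norm, ← norm_iteratedFDeriv_fderiv, norm_iteratedFDeriv_one, hfdd,
      Real.norm_of_nonneg (Real.rpow_nonneg hxpos.le _)] at hx2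
    have hmono : ∀ (c : ℝ) (s t : ℝ), c ≤ K → t ≤ s → c * ‖x‖ ^ t ≤ K * ‖x‖ ^ s := by
      intro c s t hc hts
      have h1 : ‖x‖ ^ t ≤ ‖x‖ ^ s := Real.rpow_le_rpow_of_exponent_le hx1' hts
      calc c * ‖x‖ ^ t ≤ K * ‖x‖ ^ t := mul_le_mul_of_nonneg_right hc (Real.rpow_nonneg hxpos.le _)
        _ ≤ K * ‖x‖ ^ s := mul_le_mul_of_nonneg_left h1 hK0
    refine ⟨hx0.trans (hmono c₀ _ _ (le_max_left _ _) ?_),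
      hx1.trans (hmono c₁ _ _ ((le_max_left _ _).trans (le_max_right _ _)) ?_),
      hx2.trans (hmono c₂ _ _ ((le_max_right _ _).trans (le_max_right _ _)) ?_)⟩
    · simp only [CharP.cast_eq_zero, sub_zero]; linarith
    · simp only [Nat.cast_one]; linarith
    · simp only [Nat.cast_ofNat]; linarith
  obtain ⟨ρ, hρ⟩ := exists_radius_of_eventually hev
  exact ⟨K, ρ, hK0, hρ⟩

/-! ### The analytic package of two structures of the same end -/

variable {e e'} in
/-- **Two asymptotically flat structures of the same end provide a `TransitionDecay` package.**
If `e`, `e'` describe the same end and the metric is asymptotically flat of order `α > 1/2` in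
both, then `h = hCoeff e D`, `h' = hCoeff e' D`, the transition maps `G = transition e e'`,
`G' = transition e' e` satisfy `TransitionDecay h h' G G' α₀ K R S` for `α₀ = min α (3/4)` and
suitable `K`, `R`, `S` (radii chosen by `IsSameEnd.eventually_overlap` in both directions and by
the smallness `K r^{−α₀} ≤ 1/2`). Bartnik 1986, §3 (set-up of Cor. 3.2). [cite: Bartnik1986, §3, Cor. 3.2] -/
theorem exists_transitionDecay (hee' : IsSameEnd e e') {α : ℝ} (hα : 1 / 2 < α)
    (hAF : IsMetricAsymptoticallyFlat e D α) (hAF' : IsMetricAsymptoticallyFlat e' D α) :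
    ∃ α₀ K R S : ℝ, 1 / 2 < α₀ ∧ e.R ≤ R ∧ e'.R ≤ S ∧
      TransitionRigidity.TransitionDecay (hCoeff e D) (hCoeff e' D) (transition e e')
        (transition e' e) α₀ K R S := by
  set α₀ : ℝ := min α (3 / 4) with hα₀
  have hα₀α : α₀ ≤ α := min_le_left _ _
  have hα₀pos : 1 / 2 < α₀ := lt_min hα (by norm_num)
  have hα₀lt : α₀ < 1 := (min_le_right _ _).trans_lt (by norm_num)
  obtain ⟨K₁, ρ₁, hK₁, hb₁⟩ := e.exists_decay_bounds D hα₀α hAF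
  obtain ⟨K₂, ρ₂, hK₂, hb₂⟩ := e'.exists_decay_bounds D hα₀α hAF'
  set K : ℝ := max K₁ K₂ with hK
  have hK0 : 0 ≤ K := hK₁.trans (le_max_left _ _)
  -- smallness radius
  have hsmall : ∀ᶠ r : ℝ in atTop, K * r ^ (-α₀) ≤ 1 / 2 := by
    have ht : Tendsto (fun r : ℝ ↦ K * r ^ (-α₀)) atTop (𝓝 0) := by
      simpa using (tendsto_rpow_neg_atTop (by linarith : 0 < α₀)).const_mul K
    exact ht.eventually (Iic_mem_nhds (by norm_num))
  obtain ⟨r₀, hr₀⟩ := Filter.eventually_atTop.1 hsmall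
  -- the `y`-radius `S₀` for smallness of `h' − δ`
  set S₀ : ℝ := max (max ρ₂ e'.R) (max r₀ 1) with hS₀
  have hS₀' : ∀ y : E3, S₀ < ‖y‖ →
      ‖hCoeff e' D y - (innerSL ℝ : E3 →L[ℝ] E3 →L[ℝ] ℝ)‖ ≤ 1 / 2 := by
    intro y hy
    have hyρ : ρ₂ ≤ ‖y‖ := by
      have := le_max_left ρ₂ e'.R; have := le_max_left (max ρ₂ e'.R) (max r₀ 1); linarith
    have hyr : r₀ ≤ ‖y‖ := by
      have := le_max_left r₀ 1; have := le_max_right (max ρ₂ e'.R) (max r₀ 1); linarith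
    have hy0 : 0 < ‖y‖ := by
      have := le_max_right r₀ 1; have := le_max_right (max ρ₂ e'.R) (max r₀ 1); linarith
    calc _ ≤ K₂ * ‖y‖ ^ (-α₀) := (hb₂ y hyρ).1
      _ ≤ K * ‖y‖ ^ (-α₀) :=
          mul_le_mul_of_nonneg_right (le_max_right _ _) (Real.rpow_nonneg hy0.le _)
      _ ≤ 1 / 2 := hr₀ _ hyr
  -- the `x`-radius `R`
  obtain ⟨R₁, hR₁e, hR₁⟩ := hee'.symm.eventually_overlap S₀
  set R : ℝ := max R₁ (max ρ₁ (max r₀ 1)) with hR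
  have hRR₁ : R₁ ≤ R := le_max_left _ _
  have hRρ₁ : ρ₁ ≤ R := (le_max_left _ _).trans (le_max_right _ _)
  have hRr₀ : r₀ ≤ R := ((le_max_left _ _).trans (le_max_right _ _)).trans (le_max_right _ _)
  have hR1 : 1 ≤ R := ((le_max_right _ _).trans (le_max_right _ _)).trans (le_max_right _ _)
  -- the `y`-radius `S`
  obtain ⟨S₁, hS₁e, hS₁⟩ := hee'.eventually_overlap (R + 1)
  set S : ℝ := max S₁ S₀ with hS
  have hSS₁ : S₁ ≤ S := le_max_left _ _
  have hSS₀ : S₀ ≤ S := le_max_right _ _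
  have hS₀ρ₂ : ρ₂ ≤ S₀ := (le_max_left _ _).trans (le_max_left _ _)
  have hS₀r₀ : r₀ ≤ S₀ := (le_max_left _ _).trans (le_max_right _ _)
  have hS₀1 : 1 ≤ S₀ := (le_max_right _ _).trans (le_max_right _ _)
  refine ⟨α₀, K, R, S, hα₀pos, hR₁e.trans hRR₁, hS₁e.trans hSS₁, ?_⟩
  exact
  { α_pos := by linarith
    α_lt_one := hα₀lt
    K_nonneg := hK0
    one_le_R := hR1
    one_le_S := hS₀1.trans hSS₀
    small_R := hr₀ R hRr₀
    small_S := hr₀ S (hS₀r₀.trans hSS₀)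
    contDiffAt_h := fun x hx ↦ e.contDiffAt_hCoeff D (by linarith)
    symm_h := fun x v w ↦ hCoeff_symm e D x v w
    norm_h_sub_le := fun x hx ↦ ((hb₁ x (by linarith)).1).trans
      (mul_le_mul_of_nonneg_right (le_max_left _ _) (Real.rpow_nonneg (norm_nonneg _) _))
    norm_fderiv_h_le := fun x hx ↦ ((hb₁ x (by linarith)).2.1).trans
      (mul_le_mul_of_nonneg_right (le_max_left _ _) (Real.rpow_nonneg (norm_nonneg _) _))
    norm_fderiv_fderiv_h_le := fun x hx ↦ ((hb₁ x (by linarith)).2.2).trans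
      (mul_le_mul_of_nonneg_right (le_max_left _ _) (Real.rpow_nonneg (norm_nonneg _) _))
    differentiableAt_G' := fun x hx ↦
      (contDiffAt_transition (hR₁ x (by linarith)).1).differentiableAt (by simp)
    law' := fun x hx v w ↦ hCoeff_transition D (hR₁ x (by linarith)).1 v w
    small_G' := fun x hx ↦ hS₀' _ (hR₁ x (by linarith)).2
    contDiffAt_h' := fun y hy ↦ e'.contDiffAt_hCoeff D (by linarith)
    norm_h'_sub_le := fun y hy ↦ ((hb₂ y (by linarith)).1).trans
      (mul_le_mul_of_nonneg_right (le_max_right _ _) (Real.rpow_nonneg (norm_nonneg _) _))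
    norm_fderiv_h'_le := fun y hy ↦ ((hb₂ y (by linarith)).2.1).trans
      (mul_le_mul_of_nonneg_right (le_max_right _ _) (Real.rpow_nonneg (norm_nonneg _) _))
    contDiffAt_G := fun y hy ↦ contDiffAt_transition (hS₁ y (by linarith)).1
    far_G := fun y hy ↦ (hS₁ y (by linarith)).2.le
    law := fun y hy v w ↦ hCoeff_transition D (hS₁ y (by linarith)).1 v w
    left_inv := fun y hy ↦ transition_transition (hS₁ y (by linarith)).1 }

/-! ### Sphere integrals against `μHE[2]` -/

/-- **Rotation invariance of sphere integrals**: for a linear isometry `O` of `ℝ³`,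
`∫_{‖y‖ = r} F(O y) dμHE[2](y) = ∫_{‖x‖ = r} F(x) dμHE[2](x)` (`μHE[2]` is invariant under
isometries, Mathlib `IsometryEquiv.measurePreserving_euclideanHausdorffMeasure`, and `O` preserves
round spheres). [folklore] -/
theorem setIntegral_sphere_comp_isometry (O : E3 ≃ₗᵢ[ℝ] E3) (F : E3 → ℝ) (r : ℝ) :
    ∫ y in sphere (0 : E3) r, F (O y) ∂(μHE[2] : Measure E3) =
      ∫ x in sphere (0 : E3) r, F x ∂(μHE[2] : Measure E3) := by
  have hmp : MeasurePreserving (O : E3 → E3) (μHE[2] : Measure E3) (μHE[2] : Measure E3) :=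
    O.toIsometryEquiv.measurePreserving_euclideanHausdorffMeasure 2
  have hme : MeasurableEmbedding (O : E3 → E3) :=
    O.toContinuousLinearEquiv.toHomeomorph.measurableEmbedding
  have hpre : (O : E3 → E3) ⁻¹' sphere (0 : E3) r = sphere (0 : E3) r := by
    ext y
    simp
  have := hmp.setIntegral_preimage_emb hme F (sphere (0 : E3) r)
  rwa [hpre] at this

/-- **Surface measure of round spheres**: `μHE[2](S_r) = r² μHE[2](S_1)` for `r > 0`, and this
is finite. [folklore] -/
theorem euclideanHausdorff_sphere_eq {r : ℝ} (hr : 0 < r) :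
    (μHE[2] : Measure E3) (sphere (0 : E3) r) =
      ((‖r‖₊ ^ 2 : NNReal) : ENNReal) * (μHE[2] : Measure E3) (sphere (0 : E3) 1) := by
  rw [← MeasureTheory.Hausdorff.smul_unitSphere hr,
    Measure.euclideanHausdorffMeasure_smul₀ 2 hr.ne' (sphere (0 : E3) 1), ENNReal.smul_def,
    smul_eq_mul]

/-- A function continuous on a round sphere of `ℝ³` is integrable on it against `μHE[2]`
(bounded on a compact set of finite measure). [folklore] -/
theorem integrableOn_sphere_of_continuousOn {F : E3 → ℝ} {r : ℝ}
    (hF : ContinuousOn F (sphere (0 : E3) r)) :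
    IntegrableOn F (sphere (0 : E3) r) (μHE[2] : Measure E3) := by
  have hd : Module.finrank ℝ E3 = 2 + 1 := by simp
  obtain ⟨M, hM⟩ := (isCompact_sphere (0 : E3) r).exists_bound_of_continuousOn hF
  refine IntegrableOn.of_bound (MeasureTheory.Hausdorff.euclideanHausdorffMeasure_sphere_lt_top hd r)
    (hF.aestronglyMeasurable isClosed_sphere.measurableSet) M ?_
  exact (ae_restrict_iff' isClosed_sphere.measurableSet).2 (ae_of_all _ hM)

/-! ### Bartnik's uniqueness theorem -/

/-- **DISCHARGE of `HasADMEnergy.Of_isSameEnd` (Bartnik's uniqueness theorem for the ADM energy,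
CPAM 39 (1986), Thm. 4.2 with Cor. 3.2; Chruściel 1986).** The ADM energy does not depend on the
structure at infinity: for two end structures `e`, `e'` of the same end, both metrically
asymptotically flat of order `α > 1/2`, if the fluxes of `e` converge to `m` then so do those of
`e'`. See the module docstring for the proof; the integrability of the scalar curvature is not
used. The standing instance `[D.metric.HasLeviCivita]` of the fact is supplied outright by
`PseudoRiemannianMetric.hasLeviCivita` (a `Prop`, so by proof irrelevance this is the fact for
every instance). [cite: Bartnik1986, §4, Thm. 4.2 and §3, Cor. 3.2] -/
theorem HasADMEnergy.Of_isSameEnd_holds :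
    haveI := D.metric.hasLeviCivita
    HasADMEnergy.Of_isSameEnd D := by
  haveI := D.metric.hasLeviCivita
  intro e e' m hm hee' α hα hAF hAF' R' _hR' _hint
  classical
  -- (1) the analytic package and the rotation
  obtain ⟨α₀, K, R, S, hα₀, heR, he'S, hd⟩ := exists_transitionDecay D hee' hα hAF hAF'
  have h3 : 2 ≤ Module.finrank ℝ E3 := by simp
  obtain ⟨O, S₁, C, hS₁, hr⟩ := hd.exists_rotationBounds h3
  set b := EuclideanSpace.basisFun (Fin 3) ℝ with hb
  -- (2) the ADM fields of the two structures
  set V : E3 → E3 := fun x ↦ ∑ i, (∑ j, (partialH e D j i j x - partialH e D i j j x)) •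
    EuclideanSpace.basisFun (Fin 3) ℝ i with hVdef
  have hV : ∀ x, V x = ∑ i, (∑ j, (partialH e D j i j x - partialH e D i j j x)) •
      EuclideanSpace.basisFun (Fin 3) ℝ i := fun x ↦ rfl
  set V' : E3 → E3 := fun x ↦ ∑ i, (∑ j, (partialH e' D j i j x - partialH e' D i j j x)) •
    EuclideanSpace.basisFun (Fin 3) ℝ i with hV'def
  have hV' : ∀ x, V' x = ∑ i, (∑ j, (partialH e' D j i j x - partialH e' D i j j x)) •
      EuclideanSpace.basisFun (Fin 3) ℝ i := fun x ↦ rfl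
  -- (3) the cut-off curl form and its ADM vector
  obtain ⟨β, hβ2, hβanti, hβ0, hβeq⟩ := TransitionRigidity.exists_cutoff_curlGen O
    (G := transition e e') (S := S) (by linarith [hd.one_le_S]) hd.contDiffAt_G
  set c : E3 → E3 := fun y ↦ ∑ i, (∑ j, (fderiv ℝ (fun z ↦ β z (b i) (b j)) y (b j) -
    fderiv ℝ (fun z ↦ β z (b j) (b j)) y (b i))) • b i with hcdef
  have hc : ∀ y, c y = ∑ i, (∑ j, (fderiv ℝ (fun z ↦ β z (b i) (b j)) y (b j) -
      fderiv ℝ (fun z ↦ β z (b j) (b j)) y (b i))) • b i := fun y ↦ rfl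
  -- (4) the pointwise comparison
  obtain ⟨Sstar, Cstar, hSstar, hCstar, hpt⟩ :=
    TransitionRigidity.exists_abs_flux_density_sub_le b hd hr hS₁ (e.admVec_repr D V hV)
      (e'.admVec_repr D V' hV') hβeq hc
  -- (5) continuity of the three flux densities on far spheres
  have hcC1 : ContDiff ℝ 1 c := contDiff_iff_contDiffAt.2 fun x ↦
    contDiffAt_admVec b hc hβ2.contDiffAt (by norm_num)
  have hVcont : ∀ x : E3, e.R < ‖x‖ → ContinuousAt V x := fun x hx ↦
    (contDiffAt_admVec b (e.admVec_repr D V hV) (e.contDiffAt_hCoeff D hx)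
      (by rw [show (1 : ℕ∞ω) + 1 = 2 by norm_num]; exact WithTop.coe_le_coe.mpr le_top)
        : ContDiffAt ℝ 1 V x).continuousAt
  have hV'cont : ∀ y : E3, e'.R < ‖y‖ → ContinuousAt V' y := fun y hy ↦
    (contDiffAt_admVec b (e'.admVec_repr D V' hV') (e'.contDiffAt_hCoeff D hy)
      (by rw [show (1 : ℕ∞ω) + 1 = 2 by norm_num]; exact WithTop.coe_le_coe.mpr le_top)
        : ContDiffAt ℝ 1 V' y).continuousAt
  -- (6) the flux comparison on far spheres
  have hd3 : Module.finrank ℝ E3 = 2 + 1 := by simp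
  set κ : ℝ := ((μHE[2] : Measure E3) (sphere (0 : E3) 1)).toReal with hκ
  have hunit : ∀ y : E3, 0 < ‖y‖ → ContinuousAt (fun y : E3 ↦ ‖y‖⁻¹ • y) y := fun y hy ↦
    ((continuousAt_id.norm.inv₀ hy.ne')).smul continuousAt_id
  set ρ : ℝ := max Sstar (max R S) + 1 with hρ
  have hflux : ∀ r : ℝ, ρ ≤ r →
      |admEnergyFlux e' D r - admEnergyFlux e D r| ≤
        (16 * Real.pi)⁻¹ * (Cstar * r ^ (-2 * α₀ - 1) * (r ^ 2 * κ)) := by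
    intro r hrρ
    have hrS : Sstar ≤ r := by
      have := le_max_left Sstar (max R S); linarith
    have hrR : R < r := by
      have := le_max_left R S; have := le_max_right Sstar (max R S); linarith
    have hrS' : S < r := by
      have := le_max_right R S; have := le_max_right Sstar (max R S); linarith
    have hr0 : 0 < r := by linarith [hd.one_le_R]
    have hre : e.R < r := by linarith
    have hre' : e'.R < r := by linarith
    -- both fluxes as sphere integrals of the flux densities
    have eE : admEnergyFlux e D r = (16 * Real.pi)⁻¹ *
        ∫ x in sphere (0 : E3) r, ⟪‖x‖⁻¹ • x, V x⟫ ∂(μHE[2] : Measure E3) := by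
      unfold admEnergyFlux
      congr 1
      exact setIntegral_congr_fun isClosed_sphere.measurableSet fun x hx ↦
        e.flux_integrand_eq D V hV (mem_sphere_zero_iff_norm.1 hx)
    have eE' : admEnergyFlux e' D r = (16 * Real.pi)⁻¹ *
        ∫ y in sphere (0 : E3) r, ⟪‖y‖⁻¹ • y, V' y⟫ ∂(μHE[2] : Measure E3) := by
      unfold admEnergyFlux
      congr 1
      exact setIntegral_congr_fun isClosed_sphere.measurableSet fun x hx ↦
        e'.flux_integrand_eq D V' hV' (mem_sphere_zero_iff_norm.1 hx)
    -- rotation invariance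
    have erot : ∫ x in sphere (0 : E3) r, ⟪‖x‖⁻¹ • x, V x⟫ ∂(μHE[2] : Measure E3) =
        ∫ y in sphere (0 : E3) r, ⟪‖O y‖⁻¹ • O y, V (O y)⟫ ∂(μHE[2] : Measure E3) :=
      (setIntegral_sphere_comp_isometry O (fun x ↦ ⟪‖x‖⁻¹ • x, V x⟫) r).symm
    -- the curl flux vanishes
    have ecurl : ∫ y in sphere (0 : E3) r, ⟪‖y‖⁻¹ • y, c y⟫ ∂(μHE[2] : Measure E3) = 0 := by
      rw [MeasureTheory.Hausdorff.setIntegral_sphere_euclideanHausdorff hd3 hr0,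
        sphereIntegral_admVec_eq_zero_of_antisymm volume b hc hβ2 hβanti (R₀ := S + 1)
          (by linarith [hd.one_le_S]) hβ0 hr0, smul_zero]
    -- integrability on the sphere
    have i1 : IntegrableOn (fun y ↦ ⟪‖y‖⁻¹ • y, V' y⟫) (sphere (0 : E3) r)
        (μHE[2] : Measure E3) := by
      refine integrableOn_sphere_of_continuousOn fun y hy ↦ ContinuousAt.continuousWithinAt ?_
      have hyr : ‖y‖ = r := mem_sphere_zero_iff_norm.1 hy
      exact (hunit y (by rw [hyr]; exact hr0)).inner (hV'cont y (by rw [hyr]; exact hre'))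
    have i2 : IntegrableOn (fun y ↦ ⟪‖O y‖⁻¹ • O y, V (O y)⟫) (sphere (0 : E3) r)
        (μHE[2] : Measure E3) := by
      refine integrableOn_sphere_of_continuousOn fun y hy ↦ ContinuousAt.continuousWithinAt ?_
      have hyr : ‖O y‖ = r := by rw [O.norm_map]; exact mem_sphere_zero_iff_norm.1 hy
      have hO : ContinuousAt (fun y : E3 ↦ O y) y := O.continuous.continuousAt
      exact ((hunit (O y) (by rw [hyr]; exact hr0)).comp hO).inner
        ((hVcont (O y) (by rw [hyr]; exact hre)).comp hO)
    have i3 : IntegrableOn (fun y ↦ ⟪‖y‖⁻¹ • y, c y⟫) (sphere (0 : E3) r)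
        (μHE[2] : Measure E3) := by
      refine integrableOn_sphere_of_continuousOn fun y hy ↦ ContinuousAt.continuousWithinAt ?_
      have hyr : ‖y‖ = r := mem_sphere_zero_iff_norm.1 hy
      exact (hunit y (by rw [hyr]; exact hr0)).inner hcC1.continuous.continuousAt
    -- the difference of the fluxes as one sphere integral
    have e12 : ∫ y in sphere (0 : E3) r, (⟪‖y‖⁻¹ • y, V' y⟫ - ⟪‖O y‖⁻¹ • O y, V (O y)⟫)
        ∂(μHE[2] : Measure E3) = (∫ y in sphere (0 : E3) r, ⟪‖y‖⁻¹ • y, V' y⟫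
          ∂(μHE[2] : Measure E3)) -
          ∫ y in sphere (0 : E3) r, ⟪‖O y‖⁻¹ • O y, V (O y)⟫ ∂(μHE[2] : Measure E3) :=
      integral_sub i1 i2
    have e123 : ∫ y in sphere (0 : E3) r, (⟪‖y‖⁻¹ • y, V' y⟫ - ⟪‖O y‖⁻¹ • O y, V (O y)⟫ -
          ⟪‖y‖⁻¹ • y, c y⟫) ∂(μHE[2] : Measure E3) =
        (∫ y in sphere (0 : E3) r, (⟪‖y‖⁻¹ • y, V' y⟫ - ⟪‖O y‖⁻¹ • O y, V (O y)⟫)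
          ∂(μHE[2] : Measure E3)) -
          ∫ y in sphere (0 : E3) r, ⟪‖y‖⁻¹ • y, c y⟫ ∂(μHE[2] : Measure E3) :=
      integral_sub (i1.sub i2) i3
    have hdiff : admEnergyFlux e' D r - admEnergyFlux e D r = (16 * Real.pi)⁻¹ *
        ∫ y in sphere (0 : E3) r, (⟪‖y‖⁻¹ • y, V' y⟫ - ⟪‖O y‖⁻¹ • O y, V (O y)⟫ -
          ⟪‖y‖⁻¹ • y, c y⟫) ∂(μHE[2] : Measure E3) := by
      rw [e123, e12, ecurl, sub_zero, eE', eE, erot, mul_sub]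
    rw [hdiff, abs_mul, abs_of_pos (by positivity : (0 : ℝ) < (16 * Real.pi)⁻¹)]
    refine mul_le_mul_of_nonneg_left ?_ (by positivity)
    -- bound the integral
    have hbound := norm_setIntegral_le_of_norm_le_const (μ := (μHE[2] : Measure E3))
      (s := sphere (0 : E3) r) (C := Cstar * r ^ (-2 * α₀ - 1))
      (f := fun y ↦ ⟪‖y‖⁻¹ • y, V' y⟫ - ⟪‖O y‖⁻¹ • O y, V (O y)⟫ - ⟪‖y‖⁻¹ • y, c y⟫)
      (MeasureTheory.Hausdorff.euclideanHausdorffMeasure_sphere_lt_top hd3 r)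
      (fun y hy ↦ by
        have hyr : ‖y‖ = r := mem_sphere_zero_iff_norm.1 hy
        rw [Real.norm_eq_abs, ← hyr]
        exact hpt y (by rw [hyr]; exact hrS))
    have hreal : (μHE[2] : Measure E3).real (sphere (0 : E3) r) = r ^ 2 * κ := by
      rw [measureReal_def, euclideanHausdorff_sphere_eq hr0, ENNReal.toReal_mul, hκ]
      congr 1
      rw [ENNReal.coe_toReal, NNReal.coe_pow, coe_nnnorm, Real.norm_eq_abs, abs_of_pos hr0]
    rw [Real.norm_eq_abs, hreal] at hbound
    exact hbound
  -- (7) the limit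
  have hlim0 : Tendsto (fun r : ℝ ↦ (16 * Real.pi)⁻¹ * (Cstar * r ^ (-2 * α₀ - 1) * (r ^ 2 * κ)))
      atTop (𝓝 0) := by
    have heq : ∀ r : ℝ, 0 < r → (16 * Real.pi)⁻¹ * (Cstar * r ^ (-2 * α₀ - 1) * (r ^ 2 * κ)) =
        ((16 * Real.pi)⁻¹ * Cstar * κ) * r ^ (-(2 * α₀ - 1)) := by
      intro r hr
      have : r ^ (-2 * α₀ - 1) * r ^ 2 = r ^ (-(2 * α₀ - 1)) := by
        rw [← Real.rpow_natCast r 2, ← Real.rpow_add hr]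
        congr 1; push_cast; ring
      calc _ = ((16 * Real.pi)⁻¹ * Cstar * κ) * (r ^ (-2 * α₀ - 1) * r ^ 2) := by ring
        _ = _ := by rw [this]
    have h1 : Tendsto (fun r : ℝ ↦ ((16 * Real.pi)⁻¹ * Cstar * κ) * r ^ (-(2 * α₀ - 1))) atTop
        (𝓝 0) := by
      simpa using (tendsto_rpow_neg_atTop (by linarith : 0 < 2 * α₀ - 1)).const_mul
        ((16 * Real.pi)⁻¹ * Cstar * κ)
    refine h1.congr' ?_
    filter_upwards [eventually_gt_atTop (0 : ℝ)] with r hr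
    exact (heq r hr).symm
  have hdiff0 : Tendsto (fun r ↦ admEnergyFlux e' D r - admEnergyFlux e D r) atTop (𝓝 0) := by
    refine squeeze_zero_norm' ?_ hlim0
    filter_upwards [eventually_ge_atTop ρ] with r hr
    rw [Real.norm_eq_abs]
    exact hflux r hr
  have hm' : Tendsto (admEnergyFlux e D) atTop (𝓝 m) := hm
  have key : Tendsto (admEnergyFlux e' D) atTop (𝓝 (m + 0)) :=
    (hm'.add hdiff0).congr fun r ↦ by ring
  rw [add_zero] at key
  exact key

end AFEnd

end Literature.Geometry.Lorentzian

end
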